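import Summits.NavierStokesRegularity.NavierStokesRegularity.Theses.PerpetualPump
import Summits.NavierStokesRegularity.NavierStokesRegularity.Theorems.CircuitPump.Negative.WitnessStructure
import Literature.Analysis.Convex.SchauderFixedPoint
import HarnessLib.Audit

/-!
# Line `wire-decoupling` for crux `PerpetualPump.CircuitPump` (stmt-NavierStokesRegularity-1834)

Skeleton (crux-plan, planner-cruxplan-stmt-NavierStokesRegularity-1834-wire-decoupling-0, 2026-08-16), from
crux idea card `Cruxes/CircuitPump/Ideas/wire-decoupling.md` (ideator 2, round 1; triage r1-2 PASS, r1-3 PASS,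
sharpenings acted on below). POSITIVE line. `circuitPump_of_parts` is the sorry-free composition of the five
registered stubs (plus the PROVED clamp fixed point) into `Wrap IsPump` (the crux through the LANDED negative-side vocabulary
`Theorems/CircuitPump/Negative/LoadBearing.lean`, `circuitPump_iff : CircuitPump ↔ Wrap IsPump` is `Iff.rfl`), and
`CircuitPump_of : Theses.PerpetualPump.CircuitPump` concludes the route decl BY NAME (unique
`#h21_check_skeleton` theorem; closed = false until the stubs land). Stub statements are plain `def … : Prop`.

## The line in one paragraph

DECOUPLE THE DSS PERIOD FROM THE LATTICE SPACING. The crux asks `∀ lam₀ ∃ lam < lam₀ ∃ m coeff k X`: the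
period `k` and the alphabet size `m` are chosen AFTER `lam`. Fix ONE coarse renormalisation ratio `Λ > 1` and
realise it on the fine lattice `lam = Λ^{1/(q+1)}` with period `k = q+1` and `m = q+4` species: Tao's
4-mode COLLECTOR `a,b,c,d` (Table 2, same-shell gates: pump `ε`, seed `ε²e^{-K¹⁰}`, amplifier `ε⁻¹K¹⁰`,
rotor `ε⁻²`) sits on the shells `n ≡ 0 (mod q+1)`, and a WIRE of `q` single-mode species `w₁,…,w_q`,
joined by positive Katz–Pavlović pump-gate bonds (`{d,d,w₁}` of strength `K` = Tao's drain, `{w_r,w_r,w_{r+1}}`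
and `{w_q,w_q,a_next}` of strength `G`), carries each shed packet across the `q` intermediate shells to the
next collector (`roleRHS`: the graded circuit written in p-periodic ROLES `Y j ρ`, period `j ∈ ℤ`, role
`ρ : Fin (q+4)`; `stub_gradedEmbedding` realises it inside the crux class with a symmetric,
cyclic-cancelling structure table and transports DSS / Type I / nontriviality; `circuitPump_of_coarseFamily`,
PROVED, turns "pumps at `Λ^{1/p}` with period `p` for all large `p`" into the crux). At the coarse ratio the
latch has O(1) margins: in the SECTION "ignition of the active collector" the return law of the critical
amplitude is `α ↦ Λ^{1/5}α(1 − loss) − √2` (damped quiet phase `a = A'e^{−τ}`, fuse `½A'²(1−e^{−τ})² = 1`,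
`fuseTime A' = −log(1 − √2/A')`), expanding with slope `Λ^{1/5}` and exit faces at `α*/2`, `2α*` with
ABSOLUTE margins `√2/2`, `√2` — `stub_coarseCollector` = CHARGE ∧ FIRE for the 5-mode unit `(a,b,c,d,w₁)` in
collector critical units with exogenous straggler input `I ≥ 0` (`∫I ≤ δ`) and onward leak `ℓ ≥ 0`. The wire is
only asked to be an asymptotically perfect CONDUCTOR: `stub_wireDelivery` is the SOFT uniform delivery lemma for
the finite non-negative pump-gate chain with absorbing end (LaSalle + compactness of the energy sphere, Gronwall
for relative/absolute perturbations) — no rate is needed because `G = G(q)` is chosen after `T₀(q,δ)`.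
`stub_uniformClosing` closes the loop: from CHARGE/FIRE and WireDelivery it builds, for every `q ≥ q₀`, the
covering data of the section-to-section period map of the role system on a compact convex product box in the
Banach space `StateSpace q = (ℤ × Fin (q+4)) →ᵇ ℝ` (trail by one-way energy bookkeeping, precursor tails,
well-posedness of the infinite lattice, realisation of fixed points as one-period witnesses), with the schedule
`η → δ₀(η) → δ → δ_D → T₀(q,δ_D) → G → K ≥ max(K₀, (G²/δ)²) → ε ≤ ε₀(K)` (no circularity: nothing is uniform
in `q` except the collector, which sees the wire only through the classes of `I` and `ℓ`).
`clampFixedPoint_holds` (u = 1 covering ⇒ fixed point: clamp trick + Schauder in tree; PROVED here) gives the fixed point,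
the realisation clause a `OnePeriodWitness`, `stub_periodicExtension` (the section form of `dss_extension`)
the ancient exactly-DSS Type-I role solution, `stub_gradedEmbedding` the pump `PumpAt (Λ^{1/(q+1)}) (q+1)`.

## Registered stubs (5) + proved glue

* `GradedEmbedding` / `stub_gradedEmbedding` (P1, L) — graded table on `Fin (q+4)` is legal; role solution ⇒ `PumpAt`.
* `PeriodicExtension` / `stub_periodicExtension` (M–L) — one-period role witness on `[t₀,t₁]` ⇒ ancient DSS Type-I solution.
* `ClampFixedPoint` — PROVED here (`clampFixedPoint_holds`: clamp trick + tree Schauder); u = 1 covering ⇒ fixed point.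
* `WireDelivery` / `stub_wireDelivery` (K2, L) — soft uniform delivery of the finite positive chain into an absorbing end.
* `CoarseCollectorCycle` / `stub_coarseCollector` (K1, XL, HARDEST) — `ChargeFuse ∧ FireDrain` for Tao's unit at O(1) damping.
* `UniformClosing` / `stub_uniformClosing` (K3, XL) — collector + wire ⇒ covering data of the period map for all `q ≥ q₀`.

## Disproof / negatives / triage honoured

* `Cruxes/CircuitPump/Disproof.lean` v2 (cdisprove): no `_false_without_<H>` theorem exists; its load-bearing
  analysis (`withoutTypeI/ODE/Nontrivial_holds`) says all difficulty is ODE ∧ Type-I ∧ nontrivial — here ODE =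
  `stub_gradedEmbedding` + the role ODE in every analytic stub, Type I = the weighted bound of `OnePeriodWitness`
  propagated by `stub_periodicExtension`, nontrivial = `α ≥ α₁ > 0` at the section. Landed Negative lemmas
  (`Theorems.CircuitPumpNegative.no_free_mode`, `steady_mode_trivial`, `dss_up/down`, `scalar_coeff_iff`) are
  IMPORTED here and respected: every role is nonlinearly forced (additive sources: `a ∋ G w_q²`, `b ∋ εa²`,
  `c ∋ ε²e^{−K¹⁰}a²`, `d ∋ ε⁻²ca`, `w_r ∋ G w_{r−1}²`, `w₁ ∋ K d²`), the witness is a travelling front (not steady,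
  bi-infinite support by construction), `m = q+4 ≥ 5` (the scalar `m = 1` sub-case, numerically dead at α = 2/5,
  is only the calibration "a wire alone fizzles").
* `ledger negatives --problem NavierStokesRegularity`: 1 entry (stmt-0154) — unrelated.
* Triage r1-2: (1) `Λ` is existential (`UniformClosing` chooses it; nothing forces `Λ^{2/5} = 2`); (2) the collector
  step is stated as Thm-5.3-type single-circuit statements (CHARGE, FIRE) with the damped quiet phase and a wire
  node as drain recipient with leak class `ℓ ≤ δ + Mt`, `M ≤ δ√K` — not as Prop 6.5; (S3) no in-tree box is
  assumed: CHARGE/FIRE are state-based and start from explicit classes. Triage r1-3: (1) the delivery fraction is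
  not a constant — `WireDelivery` is ∀δ ∃T₀(q,δ) and `G`, `K` are chosen after it; (2)–(3) echo trains / sign
  swings of the absorber are energy-capped (one-way gates into non-negative nodes; the two-way end gate can only
  return the absorber's own straggler energy) — booked in `UniformClosing`'s trail sub-goal; (4) compactness:
  the box is a compact convex product (`ClampFixedPoint` is Schauder on `[A₁,A₂] × C`, no condensing-map theory).
-/

set_option linter.dupNamespace false
set_option linter.unusedVariables false

noncomputable section

open scoped BigOperators BoundedContinuousFunction
open Real Set MeasureTheory

namespace Summit.NavierStokesRegularity.NavierStokesRegularity.Cruxes.CircuitPump.WireDecoupling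

/-! ## The crux at a fixed ratio and period (landed negative-side vocabulary) -/

/-- "There is a Type-I, exactly `k`-DSS, nontrivial ancient solution of SOME Tao circuit at scale ratio `lam`":
the crux body (`Theorems.CircuitPumpNegative.IsPump`, landed) with `m, coeff, X` existential. -/
def PumpAt (lam : ℝ) (k : ℕ) : Prop :=
  ∃ (m : ℕ) (coeff : Fin m → Fin m → Fin m → Option (Fin 3) → ℝ) (X : Fin m → ℤ → ℝ → ℝ),
    Theorems.CircuitPumpNegative.IsPump lam m coeff k X

/-- For `Λ > 1`, `lam₀ > 1` there is `p ≥ p₀`, `p > 0` with `1 < Λ^{1/p} < lam₀`. -/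
theorem exists_root_lt (Λ lam₀ : ℝ) (hΛ : 1 < Λ) (h₀ : 1 < lam₀) (p₀ : ℕ) :
    ∃ p : ℕ, p₀ ≤ p ∧ 0 < p ∧ 1 < Λ ^ (1 / (p : ℝ)) ∧ Λ ^ (1 / (p : ℝ)) < lam₀ := by
  have hΛpos : 0 < Λ := by linarith
  have hlog₀ : 0 < Real.log lam₀ := Real.log_pos h₀
  have hlogΛ : 0 < Real.log Λ := Real.log_pos hΛ
  obtain ⟨p, hp⟩ := exists_nat_gt (max (p₀ : ℝ) (Real.log Λ / Real.log lam₀))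
  have hp₀' : (p₀ : ℝ) < p := lt_of_le_of_lt (le_max_left _ _) hp
  have hq : Real.log Λ / Real.log lam₀ < p := lt_of_le_of_lt (le_max_right _ _) hp
  have hqpos : 0 < Real.log Λ / Real.log lam₀ := div_pos hlogΛ hlog₀
  have hppos : (0 : ℝ) < p := lt_trans hqpos hq
  refine ⟨p, by exact_mod_cast hp₀'.le, by exact_mod_cast hppos, ?_, ?_⟩
  · exact Real.one_lt_rpow hΛ (by positivity)
  · rw [Real.rpow_def_of_pos hΛpos]
    have hq' : Real.log Λ < p * Real.log lam₀ := by rwa [div_lt_iff₀ hlog₀] at hq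
    calc Real.exp (Real.log Λ * (1 / (p : ℝ))) < Real.exp (Real.log lam₀) := by
          apply Real.exp_lt_exp.mpr
          have h1 : Real.log Λ * (1 / (p : ℝ)) = Real.log Λ / p := by ring
          rw [h1, div_lt_iff₀ hppos]
          linarith
      _ = lam₀ := Real.exp_log (by linarith)

/-- **COARSE PERIOD ON A FINE LATTICE** (the quantifier lever of the card, proved): if for one FIXED ratio
`Λ > 1` there are period-`p` pumps at `lam = Λ^{1/p}` for all large `p`, the crux (as `Wrap IsPump`) follows. -/
theorem circuitPump_of_coarseFamily (Λ : ℝ) (hΛ : 1 < Λ) (p₀ : ℕ)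
    (h : ∀ p : ℕ, p₀ ≤ p → 0 < p → PumpAt (Λ ^ (1 / (p : ℝ))) p) :
    Theorems.CircuitPumpNegative.Wrap Theorems.CircuitPumpNegative.IsPump := by
  intro lam₀ hlam₀
  obtain ⟨p, hp₀, hp, h1, hlt⟩ := exists_root_lt Λ lam₀ hΛ hlam₀ p₀
  obtain ⟨m, coeff, X, hB⟩ := h p hp₀ hp
  exact ⟨Λ ^ (1 / (p : ℝ)), h1, hlt, m, coeff, p, X, hB⟩

/-! ## The graded role system

Roles `ρ : Fin (q+4)`: `0,1,2,3 = a,b,c,d` (Tao's collector), `3+r = w_r` (`r = 1,…,q`, the wire). Period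
`j ∈ ℤ`. The collector of period `j` sits on shell `n₀ = (q+1)j`, wire node `r` on shell `n₀ + r`; the fine
ratio is `lam = Λ^{1/(q+1)}` so that `lam^{n₀} = Λ^j`. Weights follow the crux class (4.3): dissipation
`lam^{4n/5}`, a bond donor→recipient carries `lam^{donor shell}` on both monomials. -/

/-- The fine lattice ratio `lam = Λ^{1/(q+1)}`. -/
def fineLam (Λ : ℝ) (q : ℕ) : ℝ := Λ ^ (1 / ((q + 1 : ℕ) : ℝ))

/-- Wire position of a role: `0` for the collector roles `0,…,3`, `r` for the wire role `3+r`. -/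
def wirePos {q : ℕ} (ρ : Fin (q + 4)) : ℕ := ρ.val - 3

/-- Shell of role `ρ` in period `j`: `(q+1)j + wirePos ρ`. -/
def shellOf (q : ℕ) (j : ℤ) (ρ : Fin (q + 4)) : ℤ := ((q + 1 : ℕ) : ℤ) * j + (wirePos ρ : ℤ)

/-- Tao's same-shell gates, `a`-equation (6.1) without the drain input: `−ε⁻²cd − εab − ε²e^{−K¹⁰}ac`. -/
def blockA (ε K a b c d : ℝ) : ℝ := -(ε ^ 2)⁻¹ * c * d - ε * a * b - ε ^ 2 * Real.exp (-K ^ 10) * a * c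

/-- (6.2): `εa² − ε⁻¹K¹⁰c²`. -/
def blockB (ε K a c : ℝ) : ℝ := ε * a ^ 2 - ε⁻¹ * K ^ 10 * c ^ 2

/-- (6.3): `ε²e^{−K¹⁰}a² + ε⁻¹K¹⁰bc`. -/
def blockC (ε K a b c : ℝ) : ℝ := ε ^ 2 * Real.exp (-K ^ 10) * a ^ 2 + ε⁻¹ * K ^ 10 * b * c

/-- (6.4) without the drain loss: `ε⁻²ca`. -/
def blockD (ε c a : ℝ) : ℝ := (ε ^ 2)⁻¹ * c * a

/-- **The role vector field** of the graded collector-and-wire circuit (physical variables, all periods).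
`Y j ρ t` = amplitude of role `ρ` of period `j` at time `t`. For the collector of period `j` (shell `n₀`):
Tao's block at weight `lam^{n₀}`, the input bond `+ G lam^{n₀−1} (Y (j−1) w_q)²` into `a`, the drain bond
`− K lam^{n₀} d w₁` out of `d`; for wire node `r` (shell `n = n₀+r`): gain `K lam^{n₀} d²` (`r = 1`) resp.
`G lam^{n−1} w_{r−1}²`, loss `− G lam^{n} w_r · next` with `next = w_{r+1}` (`r < q`) resp. `a` of period
`j+1` (`r = q`); every role is damped at rate `lam^{4n/5}`. (Meaningful for `q ≥ 1`; total for all `q`.) -/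
def roleRHS (Λ : ℝ) (q : ℕ) (ε K G : ℝ) (Y : ℤ → Fin (q + 4) → ℝ → ℝ) (j : ℤ) (ρ : Fin (q + 4))
    (t : ℝ) : ℝ :=
  let lam := fineLam Λ q
  let n₀ : ℤ := ((q + 1 : ℕ) : ℤ) * j
  let n : ℤ := shellOf q j ρ
  let a := Y j ⟨0, by omega⟩ t
  let b := Y j ⟨1, by omega⟩ t
  let c := Y j ⟨2, by omega⟩ t
  let d := Y j ⟨3, by omega⟩ t
  let w₁ : ℝ := if h : 4 < q + 4 then Y j ⟨4, h⟩ t else 0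
  let next : ℝ := if h : ρ.val + 1 < q + 4 then Y j ⟨ρ.val + 1, h⟩ t else Y (j + 1) ⟨0, by omega⟩ t
  let gain : ℝ := if ρ.val = 4 then K * lam ^ (n₀ : ℝ) * d ^ 2
    else G * lam ^ ((n : ℝ) - 1) * (Y j ⟨ρ.val - 1, by have := ρ.isLt; omega⟩ t) ^ 2
  let damp : ℝ := lam ^ ((4 / 5 : ℝ) * (n : ℝ)) * Y j ρ t
  (if ρ.val = 0 then
        lam ^ (n₀ : ℝ) * blockA ε K a b c d + G * lam ^ ((n₀ : ℝ) - 1) * (Y (j - 1) ⟨q + 3, by omega⟩ t) ^ 2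
      else if ρ.val = 1 then lam ^ (n₀ : ℝ) * blockB ε K a c
      else if ρ.val = 2 then lam ^ (n₀ : ℝ) * blockC ε K a b c
      else if ρ.val = 3 then lam ^ (n₀ : ℝ) * blockD ε c a - K * lam ^ (n₀ : ℝ) * d * w₁
      else gain - G * lam ^ (n : ℝ) * Y j ρ t * next) - damp

/-- The role ODE holds at every negative time (ancient solution). -/
def RoleSolves (Λ : ℝ) (q : ℕ) (ε K G : ℝ) (Y : ℤ → Fin (q + 4) → ℝ → ℝ) : Prop :=
  ∀ (j : ℤ) (ρ : Fin (q + 4)) (t : ℝ), t < 0 → HasDerivAt (Y j ρ) (roleRHS Λ q ε K G Y j ρ t) t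

/-- Exact discrete self-similarity of the roles, one period = ratio `Λ`:
`Y_{j+1,ρ}(Λ^{-4/5} t) = Λ^{-1/5} Y_{j,ρ}(t)` (= lattice DSS with period `k = q+1` at `lam = Λ^{1/(q+1)}`). -/
def RoleDSS (Λ : ℝ) {q : ℕ} (Y : ℤ → Fin (q + 4) → ℝ → ℝ) : Prop :=
  ∀ (j : ℤ) (ρ : Fin (q + 4)) (t : ℝ), t < 0 →
    Y (j + 1) ρ (Λ ^ (-(4 / 5 : ℝ)) * t) = Λ ^ (-(1 / 5 : ℝ)) * Y j ρ t

/-- Type I in time with the crux's weight `lam^{3n/5}`, `n = shellOf q j ρ`. -/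
def RoleTypeI (Λ : ℝ) (q : ℕ) (Y : ℤ → Fin (q + 4) → ℝ → ℝ) : Prop :=
  ∃ C : ℝ, ∀ (j : ℤ) (ρ : Fin (q + 4)) (t : ℝ), t < 0 →
    (fineLam Λ q) ^ ((3 / 5 : ℝ) * (shellOf q j ρ : ℝ)) * |Y j ρ t| ≤ C / Real.sqrt (-t)

/-- Nontriviality of the roles. -/
def RoleNontrivial {q : ℕ} (Y : ℤ → Fin (q + 4) → ℝ → ℝ) : Prop :=
  ∃ (j : ℤ) (ρ : Fin (q + 4)) (t : ℝ), t < 0 ∧ Y j ρ t ≠ 0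

/-! ## Stub statement 1 — the graded embedding (card P1) -/

/-- **S1 — GRADED EMBEDDING (card P1; size L, provable now: finite case analysis + finite sums with symbolic `q`).**
For `Λ > 1`, `q ≥ 1` and ANY real parameters `ε, K, G`, an ancient solution of the role system which is
role-DSS, role-Type-I and nontrivial yields `PumpAt (Λ^{1/(q+1)}) (q+1)`. Proof plan: on `m = q+4` species put
the table `coeff` = Tao's same-shell block on species `0..3` (offset `none`; symmetric + cyclic-cancelling by
itself, cf. tree `TaoCascade.taoCoeff_symmetric/_cancelling`, declocking's `taoCoeffOpt_*`) plus the bonds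
`3→4` (strength `K`) and `4→5, …, q+2→q+3, q+3→0` (strength `G`) in the `scalarCoeff` pattern across species
(`coeff x y x e₂ = coeff y x x e₁ = −κ/2`, `coeff x x y e₃ = κ`; legality checked by triage: `Toda.lean`
`wire_isSym/_isCyc`, `legality.py` p = 3); set `X i n t := Y ((n − wirePos i)/(q+1)) i t` if `(q+1) ∣ n − wirePos i`,
else `0`; off-grade equations read `0' = 0` (every monomial has a vanishing factor), on-grade ones are `roleRHS`
(the `scalar_rhs`-type evaluation of the triple sum); DSS with `k = q+1` from `RoleDSS` and `lam^{q+1} = Λ`;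
Type I verbatim from `RoleTypeI`; `1 ≤ q+1`. Why it might fail: only by a typo in `roleRHS` (weights
`lam^{donor shell}` on both monomials of a bond are forced by cyclic cancellation — re-derive before proving). -/
def GradedEmbedding : Prop :=
  ∀ (Λ : ℝ), 1 < Λ → ∀ (q : ℕ), 1 ≤ q → ∀ (ε K G : ℝ) (Y : ℤ → Fin (q + 4) → ℝ → ℝ),
    RoleSolves Λ q ε K G Y → RoleDSS Λ Y → RoleTypeI Λ q Y → RoleNontrivial Y →
      PumpAt (Λ ^ (1 / ((q + 1 : ℕ) : ℝ))) (q + 1)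

/-! ## Stub statement 2 — periodic extension of a one-period witness (section form of `dss_extension`) -/

/-- A ONE-PERIOD ROLE WITNESS: on a closed window `[t₀,t₁]` the roles are continuous, solve the role ODE in
the interior, END IN THE RESCALED SHIFT OF THEIR START (`Y_{j+1,ρ}(t₁) = Λ^{-1/5} Y_{j,ρ}(t₀)` — a fixed
point of the section-to-section period map), are uniformly Type-I-weighted bounded, and are not all zero. -/
def OnePeriodWitness (Λ : ℝ) (q : ℕ) (ε K G : ℝ) : Prop :=
  ∃ (t₀ t₁ : ℝ) (Y : ℤ → Fin (q + 4) → ℝ → ℝ), t₀ < t₁ ∧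
    (∀ (j : ℤ) (ρ : Fin (q + 4)), ContinuousOn (Y j ρ) (Icc t₀ t₁)) ∧
    (∀ (j : ℤ) (ρ : Fin (q + 4)), ∀ t ∈ Ioo t₀ t₁, HasDerivAt (Y j ρ) (roleRHS Λ q ε K G Y j ρ t) t) ∧
    (∀ (j : ℤ) (ρ : Fin (q + 4)), Y (j + 1) ρ t₁ = Λ ^ (-(1 / 5 : ℝ)) * Y j ρ t₀) ∧
    (∃ B : ℝ, ∀ (j : ℤ) (ρ : Fin (q + 4)), ∀ t ∈ Icc t₀ t₁,
      (fineLam Λ q) ^ ((3 / 5 : ℝ) * (shellOf q j ρ : ℝ)) * |Y j ρ t| ≤ B) ∧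
    (∃ (j : ℤ) (ρ : Fin (q + 4)), ∃ t ∈ Icc t₀ t₁, Y j ρ t ≠ 0)

/-- **S2 — PERIODIC EXTENSION (size M–L; `dss_extension` of ideator 1 / triage r1-1 "TRUE", in section form).**
A one-period role witness extends to an ancient, exactly role-DSS, Type-I, nontrivial solution on `(−∞,0)`:
translate time so that the windows `W_i = [s_i, s_{i+1}]`, `s_i = −Λ^{−4i/5} T`, `T = (t₁−t₀)/(1−Λ^{−4/5})`,
tile `(−∞,0)`; put `Ŷ_{j,ρ}(t) = Λ^{−i/5} Y_{j−i,ρ}(t₀ + Λ^{4i/5}(t − s_i))` on `W_i`; the role field is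
DSS-covariant (`roleRHS (SY) = Λ^{3/5} roleRHS Y ∘ rescale`: every monomial carries `lam^{n}·amp²` or
`lam^{4n/5}·amp`), the matching condition glues values at the junctions and — because `roleRHS` depends only on
the current state and the one-sided derivatives at the window ends equal the (continuous) field — also
derivatives; the weighted bound `B` on the base window becomes `B Λ^{2i/5} ≤ B√T/√(−t)` on `W_i`;
nontriviality is carried to a negative time. Why it might fail: only mis-bookkeeping (it is gluing + scaling). -/
def PeriodicExtension : Prop :=
  ∀ (Λ : ℝ), 1 < Λ → ∀ (q : ℕ) (ε K G : ℝ), OnePeriodWitness Λ q ε K G →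
    ∃ Y : ℤ → Fin (q + 4) → ℝ → ℝ, RoleSolves Λ q ε K G Y ∧ RoleDSS Λ Y ∧ RoleTypeI Λ q Y ∧ RoleNontrivial Y

/-! ## Stub statement 3 — the u = 1 covering fixed point (triage r1-1 `covering_fixed_point_u1`) -/

/-- **S3 — CLAMP FIXED POINT (size M; abstract; Schauder is in tree as
`Literature.Analysis.Convex.exists_fixedPoint_of_isCompact_closure`).** In a real normed space `V`: `C ⊆ V`
nonempty compact convex, `A₁ < A₂`, `g : ℝ × V → ℝ` and `h : ℝ × V → V` continuous on `[A₁,A₂] × C` with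
`h([A₁,A₂] × C) ⊆ C`, and AMPLITUDE EXIT FACES `g(A₁,·) < A₁`, `g(A₂,·) > A₂` on `C`. Then some
`(A,y) ∈ (A₁,A₂) × C` has `g(A,y) = A`, `h(A,y) = y`. Proof: `Φ(A,y) = (clamp_{[A₁,A₂]}(2A − g(A,y)), h(A,y))` is a
continuous self-map of the compact convex `[A₁,A₂] × C ⊆ ℝ × V`; Schauder gives a fixed point; on the face
`A = A₁` it would force `g(A₁,y) ≥ A₁` (resp. `≤ A₂` on the other face) — contradiction — and in the interior
`2A − g = A`. No degree theory (u = 1). -/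
def ClampFixedPoint : Prop :=
  ∀ (V : Type) [NormedAddCommGroup V] [NormedSpace ℝ V] (C : Set V) (A₁ A₂ : ℝ)
    (g : ℝ → V → ℝ) (h : ℝ → V → V),
    IsCompact C → Convex ℝ C → C.Nonempty → A₁ < A₂ →
    ContinuousOn (fun p : ℝ × V => g p.1 p.2) (Icc A₁ A₂ ×ˢ C) →
    ContinuousOn (fun p : ℝ × V => h p.1 p.2) (Icc A₁ A₂ ×ˢ C) →
    (∀ A ∈ Icc A₁ A₂, ∀ y ∈ C, h A y ∈ C) →
    (∀ y ∈ C, g A₁ y < A₁) → (∀ y ∈ C, A₂ < g A₂ y) →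
      ∃ A ∈ Ioo A₁ A₂, ∃ y ∈ C, g A y = A ∧ h A y = y

/-! ## Stub statement 4 — wire delivery (card K2), soft uniform form -/

/-- **The conduction chain in collector units**: `v i`, `i < q`, are the wire nodes `w_{i+1}`, `v q` is the
ABSORBER (the next collector's `a`); bond `i → i+1` has weight `lam^{i+1}`, the last bond `q−1 → q` weight
`lam^{q}`; no source (the drain is over — its remnant, the dampings `lam^{4r/5}`, and the absorber's own slow
block dynamics are the perturbations `e i`). -/
def wireRHS (q : ℕ) (G lam : ℝ) (e : Fin (q + 1) → ℝ → ℝ) (v : Fin (q + 1) → ℝ → ℝ) (t : ℝ)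
    (i : Fin (q + 1)) : ℝ :=
  (if h : i.val < q then
      G * ((if i.val = 0 then 0 else lam ^ (i.val : ℝ) * (v ⟨i.val - 1, by omega⟩ t) ^ 2) -
        lam ^ ((i.val : ℝ) + 1) * v i t * v ⟨i.val + 1, by omega⟩ t)
    else G * lam ^ (q : ℝ) * (v ⟨q - 1, by omega⟩ t) ^ 2) + e i t

/-- **S4 — WIRE DELIVERY, soft and uniform (card K2; size L; TRUE by LaSalle + compactness + Gronwall).**
For every `q ≥ 1` and `δ > 0` there are a normalised delivery time `T₀`, a perturbation threshold `η₀` and a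
constant `C` such that, uniformly in the fine ratio `lam ∈ [1,2]`, the bond strength `G > 0` and the energy
scale `W > 0`: every solution of the perturbed chain on `[0, T₀/(GW)]` starting from NON-NEGATIVE data of total
energy `W²/2`, with perturbations in the class `|e i t| ≤ ηGW|v i t| + f(t)`, `∫₀ᵀ f ≤ θW` (`η, θ ≤ η₀`;
relative part = dampings `lam^{4r/5} ≤ 4 ≪ GW` and the absorber's pump/seed terms; L¹ part = the drain's remnant /
late-straggler pulses `Kd²` and the absorber's rotor term), keeps all amplitudes `≤ (1 + C(η+θ))W`, and at time
`T₀/(GW)` the wire holds at most the fraction `δ + C(η+θ)` of the energy and the absorber at least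
`1 − δ − C(η+θ)`. Proof plan: scale to `G = W = 1`; for `e = 0` the wire
energy `V = Σ_{i<q} v_i²/2` is non-increasing (`V̇ = −lam^{q} v_{q−1}² v_q`, nodes stay `≥ 0`, the absorber is
non-decreasing) and tends to `0` along every trajectory (ω-limit argument: `v_q → ℓ_q`; `ℓ_q = 0` forces the
zero solution, `ℓ_q > 0` forces `v_{q−1} ≡ 0` on the ω-limit set and then all nodes vanish there); openness of
`{V(t) < δ}` + monotonicity + compactness of the data sphere × `[1,2]` give a uniform `T₀`; Gronwall on `[0,T₀]`
transfers to the perturbed class. (BarbatoFlandoliMorandin2011 Thm 8's `t⁻²` law for the infinite chain is the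
sharp version; it is NOT needed: `G = G(q)` is chosen after `T₀(q,δ)`.) Why it might fail: the absolute
perturbation `θ` lets the absorber dip below `0` by `O(θ)`, harmless on `[0,T₀]` but the constant `C` must
absorb `e^{L(q)T₀}`. -/
def WireDelivery : Prop :=
  ∀ (q : ℕ), 1 ≤ q → ∀ (δ : ℝ), 0 < δ →
    ∃ T₀ : ℝ, 0 < T₀ ∧ ∃ η₀ : ℝ, 0 < η₀ ∧ ∃ C : ℝ, 0 ≤ C ∧
      ∀ (lam G W η θ : ℝ), 1 ≤ lam → lam ≤ 2 → 0 < G → 0 < W → 0 ≤ η → η ≤ η₀ → 0 ≤ θ → θ ≤ η₀ →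
      ∀ (T : ℝ), T = T₀ / (G * W) →
      ∀ (v e : Fin (q + 1) → ℝ → ℝ) (f : ℝ → ℝ),
        (∀ i, ContinuousOn (v i) (Icc 0 T)) →
        (∀ i, ∀ t ∈ Ioo 0 T, HasDerivAt (v i) (wireRHS q G lam e v t i) t) →
        (∀ i, 0 ≤ v i 0) → (∑ i, (v i 0) ^ 2 = W ^ 2) →
        ContinuousOn f (Icc 0 T) → (∀ t ∈ Icc 0 T, 0 ≤ f t) → (∫ s in (0 : ℝ)..T, f s ≤ θ * W) →
        (∀ i, ∀ t ∈ Icc 0 T, |e i t| ≤ η * (G * W) * |v i t| + f t) →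
          (∀ i, ∀ t ∈ Icc 0 T, |v i t| ≤ (1 + C * (η + θ)) * W) ∧
          (∑ i : Fin q, (v ⟨i.val, by omega⟩ T) ^ 2 ≤ (δ + C * (η + θ)) * W ^ 2) ∧
          ((1 - δ - C * (η + θ)) * W ^ 2 ≤ (v ⟨q, by omega⟩ T) ^ 2)

/-! ## Stub statement 5 — the coarse collector cycle (card K1, hardest): CHARGE ∧ FIRE

The UNIT = Tao's block `(a,b,c,d) = (u 0, u 1, u 2, u 3)` plus its first wire node `w₁ = u 4`, in the
collector's CRITICAL UNITS (amplitudes × `lam^{n₀/5}`, time × `lam^{4n₀/5}`: dissipation rate `1` on the block,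
`lam^{4/5}` on `w₁`, nonlinear weights `1`), driven by an exogenous non-negative INPUT `I` into `a`
(the incoming wire's last bond, `G lam^{-1} w_q²`) and an exogenous non-negative LEAK rate `ℓ` on `w₁`
(the outgoing wire's first bond, `G lam w₂`). Energy identity: `d/dt Σuᵢ²/2 = −Σ_{i<4}uᵢ² − (lam^{4/5}+ℓ)u₄² + I·u₀`
(block and drain conserve energy; the drain `{d,d,w₁}` is one-way into `w₁ ≥ 0`). -/

/-- Ignition level of the fuse variable `c` (Tao (6.157): `K^{-10}ε²`). -/
def cIgn (ε K : ℝ) : ℝ := ε ^ 2 * (K ^ 10)⁻¹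

/-- Seed coefficient `σ = ε²e^{−K¹⁰}`. -/
def seedCoeff (ε K : ℝ) : ℝ := ε ^ 2 * Real.exp (-K ^ 10)

/-- The damped fuse time of the coarse quiet phase: `a = A e^{−τ}`, `b = εA²(e^{−τ} − e^{−2τ})`,
`∫₀^τ b/ε = ½A²(1−e^{−τ})² = 1` at `τ = fuseTime A = −log(1 − √2/A)` (needs `A > √2`), when `a = A − √2` and
`b = √2 ε (A − √2)`. -/
def fuseTime (A : ℝ) : ℝ := -Real.log (1 - Real.sqrt 2 / A)

/-- The FIRE window `K^{-1/4}` (rotor + drain last `O(K^{-1/2}/α)` critical units). -/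
def fireTime (K : ℝ) : ℝ := K ^ (-(1 / 4 : ℝ))

/-- **The unit vector field** in collector critical units with input `I` and leak `ℓ`. -/
def unitRHS (ε K lam : ℝ) (I ℓ : ℝ → ℝ) (u : Fin 5 → ℝ → ℝ) (t : ℝ) (i : Fin 5) : ℝ :=
  let a := u 0 t
  let b := u 1 t
  let c := u 2 t
  let d := u 3 t
  let w := u 4 t
  if i = 0 then -a + blockA ε K a b c d + I t
  else if i = 1 then -b + blockB ε K a c
  else if i = 2 then -c + blockC ε K a b c
  else if i = 3 then -d + blockD ε c a - K * d * w
  else -(lam ^ (4 / 5 : ℝ)) * w + K * d ^ 2 - ℓ t * w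

/-- `u` solves the unit system on `[0,T]`: continuous on the closed interval, ODE in the open interior. -/
def UnitSolvesOn (ε K lam : ℝ) (I ℓ : ℝ → ℝ) (u : Fin 5 → ℝ → ℝ) (T : ℝ) : Prop :=
  (∀ i, ContinuousOn (u i) (Icc 0 T)) ∧ ∀ i, ∀ t ∈ Ioo 0 T, HasDerivAt (u i) (unitRHS ε K lam I ℓ u t i) t

/-- **S5a — CHARGE & FUSE (the damped quiet phase at O(1) relative damping; card K1 proper).**
Tolerance `η`, amplitude cap `Abar`; then `δ₀(η, Abar)` (class width, chosen BEFORE `K`), `K ≥ K₀`, `ε ≤ ε₀(K)`.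
A unit that starts CHARGED — `a = A ∈ [√2+η, Abar]` (the delivered packet), `|b| ≤ δε`, a fuse that has
burnt at most the fraction `δ` of its length, `0 ≤ c ≤ e^{δK¹⁰}·ε²e^{−K¹⁰}` (LOG-scale class: during delivery the
next collector accumulates the clock exponent `K¹⁰∫b/ε ≈ K¹⁰W²T_del²/2`, K-independent as a fraction of the fuse
`K¹⁰`; polynomial prefactors are invisible), `|d| ≤ K^{-20}`, `w₁ ∈ [0,δ]` — and receives stragglers `I ≥ 0`
with `∫I ≤ δ` and any leak `ℓ ≥ 0`, IGNITES exactly once, at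
`t_c = fuseTime A ± η`: `c` first reaches `cIgn` there, transversally, with `a(t_c) = A − √2 ± η`,
`b(t_c) ∈ [½, 2]·ε(A−√2)` (nominal `√2ε(A−√2)`), `|d(t_c)| ≤ K^{-15}` (nominal `K^{-20}/√2`), `w₁(t_c) ∈ [0, δ + K^{-15}]`,
and all modes stay `≤ Abar + 1` before ignition. Mechanism: before ignition `c ≤ cIgn` makes rotor and amplifier
back-reaction negligible (`ε⁻²cd ≤ K^{-25}`, `ε⁻¹K¹⁰c² ≤ ε³K^{-10}`), so `a = (A + O(δ))e^{−t}`,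
`b = εA²(e^{−t}−e^{−2t})(1+O(ε²A²))`, `log c = ∫(ε⁻¹K¹⁰b − 1) + log(seed integral)`, and `c = cIgn` when
`½A²(1−e^{−t})² = 1 + O(δ + log K/K¹⁰)` (tree: `TaoCascadeZeroScaleTc/Quiet/CLower`, re-centred on the damped
orbit; triage r1-2 S2 lists the ten displays where the additive error slot must become the signed damping).
Why it might fail: a corridor constant above is mis-set (then reshape the class, not the line); the
conformal-clock gauge (`Ideas/conformal-clock.md`) makes the intra-shell part exact if the direct re-run stalls. -/
def ChargeFuse : Prop :=
  ∀ (η : ℝ), 0 < η → ∀ (Abar : ℝ), 0 < Abar →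
    ∃ δ₀ : ℝ, 0 < δ₀ ∧ ∃ K₀ : ℝ, 1 < K₀ ∧ ∀ (K : ℝ), K₀ ≤ K →
      ∃ ε₀ : ℝ, 0 < ε₀ ∧ ∀ (ε : ℝ), 0 < ε → ε ≤ ε₀ → ∀ (δ : ℝ), 0 < δ → δ ≤ δ₀ →
      ∀ (lam A : ℝ), 1 ≤ lam → lam ≤ 2 → Real.sqrt 2 + η ≤ A → A ≤ Abar →
      ∀ (T : ℝ) (I ℓ : ℝ → ℝ) (u : Fin 5 → ℝ → ℝ), fuseTime A + η ≤ T →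
        ContinuousOn I (Icc 0 T) → ContinuousOn ℓ (Icc 0 T) →
        (∀ t ∈ Icc 0 T, 0 ≤ I t) → (∀ t ∈ Icc 0 T, 0 ≤ ℓ t) → (∀ t ∈ Icc 0 T, ∫ s in (0 : ℝ)..t, I s ≤ δ) →
        UnitSolvesOn ε K lam I ℓ u T →
        u 0 0 = A → |u 1 0| ≤ δ * ε → 0 ≤ u 2 0 → u 2 0 ≤ Real.exp (δ * K ^ 10) * seedCoeff ε K →
        |u 3 0| ≤ (K ^ 20)⁻¹ → 0 ≤ u 4 0 → u 4 0 ≤ δ →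
        ∃ tc : ℝ, 0 < tc ∧ tc ≤ T ∧ |tc - fuseTime A| ≤ η ∧
          u 2 tc = cIgn ε K ∧ (∀ t ∈ Ico 0 tc, u 2 t < cIgn ε K) ∧ 0 < unitRHS ε K lam I ℓ u tc 2 ∧
          |u 0 tc - (A - Real.sqrt 2)| ≤ η ∧
          ε * (A - Real.sqrt 2) / 2 ≤ u 1 tc ∧ u 1 tc ≤ 2 * ε * (A - Real.sqrt 2) ∧
          |u 3 tc| ≤ (K ^ 15)⁻¹ ∧ 0 ≤ u 4 tc ∧ u 4 tc ≤ δ + (K ^ 15)⁻¹ ∧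
          (∀ t ∈ Icc 0 tc, ∀ i, |u i t| ≤ Abar + 1)

/-- **S5b — FIRE & DRAIN (ignition → rotor → drain into the wire node; Tao's Thm 5.3 single circuit with a wire
node as recipient and a leak class).** Tolerance `η`, amplitude window `[αlo, αhi]`; then `δ₀`, `K ≥ K₀`,
`ε ≤ ε₀(K)`. A unit AT IGNITION — `a = α`, `b ∈ [¼,4]·εα`, `c = cIgn`, `|d| ≤ K^{-10}`, `w₁ ∈ [0, 2δ]` — with
stragglers `∫I ≤ δ` and a leak growing at most affinely, `0 ≤ ℓ(t) ≤ δ + Mt` with `M ≤ δ√K` (in the coupled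
system `ℓ = G lam w₂ ≤ G lam(ω₂ + 4G lam² α² t)`, so this is the schedule constraint `K ≳ (G²α²/δ)²`), has,
at time `fireTime K = K^{-1/4}`: the PACKET in the wire node, `|w₁ − α| ≤ ηα`; a REMNANT
`a² + d² ≤ η K^{-4} α² + 4δ²` (Tao: `K^{-20}`, `TaoCascadeZeroScaleDrainFinal`; `+4δ²` = stragglers landing after the
drain, energy-trivial); `|b| ≤ 5εα`, `c ∈ [0, 5εα]` (the amplifier conserves
`b² + c²`: `c` may eat `b`, both stay at the `εα` scale); and total energy `Σuᵢ² ≤ 4α²` throughout.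
Mechanism: rotor `ε⁻²c` ≫ drain `K w₁` ≫ leak, damping; averaged drain of `a²+d²` at rate `K w₁/2` while
`w₁` charges itself additively from `K d²` (the recipient may start at `2δ ≫ K^{-1/2}`: it only drains faster);
duration `O(K^{-1/2}/α)`; losses: damping `K^{-1/2}/α`, leak `∫ℓ ≤ δK^{-1/4} + δ/2`, pump `ε²α`, stragglers `δ`
(tree: `TaoCascadeZeroScaleRotorPhase/TauOne/Equipartition/Drain/DrainFinal`, `TaoCascadeRotorAveraging`,
`TaoCascadeDrainEnergy`). Why it might fail: the `b`-corridor `[¼,4]εα` may be too generous for the rotor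
bootstrap (Tao keeps `b ∈ [0.48ε, 4ε]` at unit amplitude) — then narrow it together with CHARGE's conclusion. -/
def FireDrain : Prop :=
  ∀ (η : ℝ), 0 < η → ∀ (αlo αhi : ℝ), 0 < αlo → αlo ≤ αhi →
    ∃ δ₀ : ℝ, 0 < δ₀ ∧ ∃ K₀ : ℝ, 1 < K₀ ∧ ∀ (K : ℝ), K₀ ≤ K →
      ∃ ε₀ : ℝ, 0 < ε₀ ∧ ∀ (ε : ℝ), 0 < ε → ε ≤ ε₀ → ∀ (δ : ℝ), 0 < δ → δ ≤ δ₀ →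
      ∀ (lam α M : ℝ), 1 ≤ lam → lam ≤ 2 → αlo ≤ α → α ≤ αhi → 0 ≤ M → M ≤ δ * Real.sqrt K →
      ∀ (T : ℝ) (I ℓ : ℝ → ℝ) (u : Fin 5 → ℝ → ℝ), fireTime K < T →
        ContinuousOn I (Icc 0 T) → ContinuousOn ℓ (Icc 0 T) → (∀ t ∈ Icc 0 T, 0 ≤ I t) →
        (∀ t ∈ Icc 0 T, ∫ s in (0 : ℝ)..t, I s ≤ δ) → (∀ t ∈ Icc 0 T, 0 ≤ ℓ t ∧ ℓ t ≤ δ + M * t) →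
        UnitSolvesOn ε K lam I ℓ u T →
        u 0 0 = α → ε * α / 4 ≤ u 1 0 → u 1 0 ≤ 4 * ε * α → u 2 0 = cIgn ε K →
        |u 3 0| ≤ (K ^ 10)⁻¹ → 0 ≤ u 4 0 → u 4 0 ≤ 2 * δ →
        |u 4 (fireTime K) - α| ≤ η * α ∧
        (u 0 (fireTime K)) ^ 2 + (u 3 (fireTime K)) ^ 2 ≤ η * (K ^ 4)⁻¹ * α ^ 2 + 4 * δ ^ 2 ∧
        |u 1 (fireTime K)| ≤ 5 * ε * α ∧ 0 ≤ u 2 (fireTime K) ∧ u 2 (fireTime K) ≤ 5 * ε * α ∧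
        (∀ t ∈ Icc 0 (fireTime K), ∑ i, (u i t) ^ 2 ≤ 4 * α ^ 2)

/-- **S5 — THE COARSE COLLECTOR CYCLE** (card K1; HARDEST; the conjunction is one stub so the lead can cut it
into CHARGE / FIRE sub-goals sharing the class constants). -/
def CoarseCollectorCycle : Prop := ChargeFuse ∧ FireDrain

/-! ## Stub statement 6 — uniform closing (card K3): the period map covers, for every large `q` -/

/-- The state space of the period map: bounded real families indexed by (period, role) — Banach, sup norm
(store Type-I-weighted section values; any other weighting is a change of coordinates). -/
abbrev StateSpace (q : ℕ) : Type := BoundedContinuousFunction (ℤ × Fin (q + 4)) ℝ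

/-- COVERING DATA of the section-to-section period map at `(Λ, q, ε, K, G)`: a compact convex shape box `C`,
an amplitude window `[A₁,A₂]`, the amplitude and shape components `(g,h)` of a map continuous on `[A₁,A₂] × C`
with `h` into `C` and amplitude EXIT faces, such that every fixed point REALISES a one-period role witness of
the role ODE with these parameters (the prover takes `(g,h)` = the true period map read at the ignition
section, rescaled by `Λ^{1/5}` and re-indexed `j+1 ↦ j`). -/
def CoveringData (Λ : ℝ) (q : ℕ) (ε K G : ℝ) : Prop :=
  ∃ (C : Set (StateSpace q)) (A₁ A₂ : ℝ) (g : ℝ → StateSpace q → ℝ)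
    (h : ℝ → StateSpace q → StateSpace q),
    IsCompact C ∧ Convex ℝ C ∧ C.Nonempty ∧ A₁ < A₂ ∧
    ContinuousOn (fun p : ℝ × StateSpace q => g p.1 p.2) (Icc A₁ A₂ ×ˢ C) ∧
    ContinuousOn (fun p : ℝ × StateSpace q => h p.1 p.2) (Icc A₁ A₂ ×ˢ C) ∧
    (∀ A ∈ Icc A₁ A₂, ∀ y ∈ C, h A y ∈ C) ∧
    (∀ y ∈ C, g A₁ y < A₁) ∧ (∀ y ∈ C, A₂ < g A₂ y) ∧
    (∀ A ∈ Icc A₁ A₂, ∀ y ∈ C, g A y = A → h A y = y → OnePeriodWitness Λ q ε K G)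

/-- **S6 — UNIFORM CLOSING (card K3 + the K2(iii) interface; size XL).** From the collector cycle (CHARGE, FIRE)
and wire delivery: there are a coarse ratio `Λ > 1` (e.g. `Λ^{1/5} = √2`; any `1 < Λ^{1/5} < 2` has exit faces
`g(α*/2) = α*/2 − √2/2`, `g(2α*) = 2α* + √2` for the section law `g(α) = Λ^{1/5}α(1−loss) − √2`,
`α* = √2/(Λ^{1/5}(1−loss)−1)`) and `q₀ ≥ 1` such that for every `q ≥ q₀` some schedule
`(ε, K, G) = (ε(q), K(q), G(q))` admits COVERING DATA. Sub-goals for the lead (one definition shared: the box):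
(a) WELL-POSEDNESS of the role system forward in time from box states in the weighted space (diagonal
dissipative linear part + locally Lipschitz quadratic part with super-exponentially weighted precursors;
positivity of wire nodes; energy identities), continuity of the ignition-section map (transversal crossing from
CHARGE); (b) THE BOX `N_q = [α₁,α₂] × C`: section = ignition of the active collector (`c₀ = cIgn` pinned),
amplitude `α = a₀ ∈ [α*/2, 2α*]`, shape coordinates with widths chosen after `(K, ε)`: active `b₀ ∈ [¼,4]εα`,
`|d₀| ≤ K^{-10}`, own wire/precursors tiny and `≥ 0`, trail coordinates (spent collectors: block energy small;
old wires: non-negative, energy-small; Type-I weight makes far-trail widths summable ⇒ `C` compact convex);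
(c) RE-ENTRY along one period: FIRE for the active unit (`ℓ ≤ δ + Mt` from the own-wire bound
`w₂ ≤ ω₂ + 4G lam²α²t`), WireDelivery on `[t₁, t₁ + T₀/(GW)]` with `e` = dampings/remnant source/absorber
block terms, then energy monotonicity of the wire for the rest of the period (gates one-way into the
non-negative absorber during its quiet phase), CHARGE for the next collector from the delivered state (its
pre-delivery accumulation `b ≤ εW²T_del ≤ δε`, `c ≤ K²⁰σ`, `d ≤ K^{-20}` fits the class because `G` is large),
trail by energy bookkeeping over the FINITE remaining critical time (spent block: sources = stragglers only;
end gates two-way only against the absorber's own straggler energy — r1-3 (2),(3)), precursors by crude weighted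
Gronwall; (d) SCHEDULE `η → δ₀ → δ → δ_D → T₀(q,δ_D) → G → K ≥ max(K₀,(4G²lam³α₂²/δ)²) → ε ≤ ε₀(K)`;
(e) REALISATION: a fixed point is a section state reproduced after one period up to shift/rescale — solve
forward over the period, read `t₀ = ` section time, `t₁ = ` next section time, matching = fixed-point
equation, weighted bound from the box, `α ≥ α₁ > 0` for nontriviality. Why it might fail: the interface
K2(iii) — delivery overlapping the next collector's early quiet phase — needs `T_del ≪ 1` AND `G ≪ K^{1/4}`;
both hold under the schedule, but the trail's hot `(b,c)` swings make spent collectors fast pass-through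
rotors for stragglers (echo energy `≤ δ²`, must be booked by energy, never by amplitude Gronwall). -/
def UniformClosing : Prop :=
  CoarseCollectorCycle → WireDelivery →
    ∃ Λ : ℝ, 1 < Λ ∧ ∃ q₀ : ℕ, 1 ≤ q₀ ∧ ∀ (q : ℕ), q₀ ≤ q →
      ∃ (ε K G : ℝ), 0 < ε ∧ 0 < K ∧ 0 < G ∧ CoveringData Λ q ε K G

/-! ## Proved glue: the clamp fixed point (S3 is NOT a stub) and the unit's energy identity -/

/-- **S3 holds** (`covering_fixed_point_u1` of triage r1-1): clamp trick + the tree's Schauder theorem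
`Literature.Analysis.Convex.exists_fixedPoint_of_mapsTo_isCompact` on the compact convex `[A₁,A₂] × C ⊆ ℝ × V`. -/
theorem clampFixedPoint_holds : ClampFixedPoint := by
  intro V _ _ C A₁ A₂ g h hCc hCconv hCne hA12 hg hh hmaps hlo hhi
  set K : Set (ℝ × V) := Icc A₁ A₂ ×ˢ C with hK
  have hKc : IsCompact K := isCompact_Icc.prod hCc
  have hKconv : Convex ℝ K := (convex_Icc A₁ A₂).prod hCconv
  have hKne : K.Nonempty := by
    obtain ⟨y, hy⟩ := hCne
    exact ⟨(A₁, y), ⟨left_mem_Icc.2 hA12.le, hy⟩⟩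
  set Φ : ℝ × V → ℝ × V := fun p => (A₁ ⊔ (A₂ ⊓ (2 * p.1 - g p.1 p.2)), h p.1 p.2) with hΦ
  have hΦcont : ContinuousOn Φ K := by
    have h1 : ContinuousOn (fun p : ℝ × V => 2 * p.1 - g p.1 p.2) K :=
      ((continuous_const.mul continuous_fst).continuousOn).sub hg
    have h2 : ContinuousOn (fun p : ℝ × V => A₁ ⊔ (A₂ ⊓ (2 * p.1 - g p.1 p.2))) K :=
      continuousOn_const.sup (continuousOn_const.inf h1)
    exact h2.prodMk hh
  have hΦmaps : MapsTo Φ K K := by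
    intro p hp
    refine ⟨⟨le_sup_left, sup_le hA12.le inf_le_left⟩, ?_⟩
    exact hmaps p.1 hp.1 p.2 hp.2
  obtain ⟨p, hpK, hpfix⟩ := Literature.Analysis.Convex.exists_fixedPoint_of_mapsTo_isCompact
    hKconv hKc.isClosed hKne hKc hΦcont hΦmaps hΦmaps
  obtain ⟨A, y⟩ := p
  obtain ⟨hAI, hyC⟩ := hpK
  have hfix1 : A₁ ⊔ (A₂ ⊓ (2 * A - g A y)) = A := congrArg Prod.fst hpfix
  have hfix2 : h A y = y := congrArg Prod.snd hpfix
  have hgA : g A y = A := by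
    rcases le_total (2 * A - g A y) A₂ with hz | hz
    · rw [inf_eq_right.2 hz] at hfix1
      rcases le_total A₁ (2 * A - g A y) with hz' | hz'
      · rw [sup_eq_right.2 hz'] at hfix1
        linarith
      · rw [sup_eq_left.2 hz'] at hfix1
        have := hlo y hyC
        rw [hfix1] at this
        linarith
    · rw [inf_eq_left.2 hz, sup_eq_right.2 hA12.le] at hfix1
      have := hhi y hyC
      rw [hfix1] at this
      linarith
  have hA1 : A₁ < A := by
    rcases eq_or_lt_of_le hAI.1 with heq | hlt
    · exfalso
      have := hlo y hyC
      rw [heq] at this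
      linarith
    · exact hlt
  have hA2 : A < A₂ := by
    rcases eq_or_lt_of_le hAI.2 with heq | hlt
    · exfalso
      have := hhi y hyC
      rw [← heq] at this
      linarith
    · exact hlt
  exact ⟨A, ⟨hA1, hA2⟩, y, hyC, hgA, hfix2⟩

/-- **Energy identity of the unit field** (sanity of the encoding: Tao's block and the drain pair `{d,d,w₁}`
conserve energy, dissipation and leak are negative, the input enters only through `a`):
`Σᵢ uᵢ·Fᵢ = −(a²+b²+c²+d²) − (lam^{4/5} + ℓ)w² + I·a`. -/
theorem unit_energy_identity (ε K lam : ℝ) (I ℓ : ℝ → ℝ) (u : Fin 5 → ℝ → ℝ) (t : ℝ) :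
    ∑ i, u i t * unitRHS ε K lam I ℓ u t i =
      -((u 0 t) ^ 2 + (u 1 t) ^ 2 + (u 2 t) ^ 2 + (u 3 t) ^ 2) - (lam ^ (4 / 5 : ℝ) + ℓ t) * (u 4 t) ^ 2 +
        I t * u 0 t := by
  simp only [Fin.sum_univ_five, unitRHS, blockA, blockB, blockC, blockD, Fin.isValue]
  simp
  ring

/-! ## The five registered stubs (bodies `sorry`; statements are the named `Prop`s above) -/

theorem stub_gradedEmbedding : GradedEmbedding := by
  sorry

theorem stub_periodicExtension : PeriodicExtension := by
  sorry

theorem stub_wireDelivery : WireDelivery := by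
  sorry

theorem stub_coarseCollector : CoarseCollectorCycle := by
  sorry

theorem stub_uniformClosing : UniformClosing := by
  sorry

/-! ## Composition (kernel-checked, sorry-free): the five stub statements + the proved clamp lemma prove the crux -/

/-- **Composition (the real proof).** Stated with conclusion `Wrap IsPump` (the crux through the landed
`circuitPump_iff`, definitionally the route decl) so that `CircuitPump_of` below is the unique by-name theorem.
Closing ⇒ `Λ`, `q₀` and covering data for every `q ≥ q₀`; coarse family with `p₀ = q₀ + 1`: for `p = q + 1`,
the PROVED clamp fixed point on `StateSpace q` ⇒ realisation ⇒ one-period witness ⇒ periodic extension ⇒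
ancient role solution ⇒ graded embedding ⇒ `PumpAt (Λ^{1/(q+1)}) (q+1)`. -/
theorem circuitPump_of_parts (hA : GradedEmbedding) (hB : PeriodicExtension)
    (hD : WireDelivery) (hC : CoarseCollectorCycle) (hF : UniformClosing) :
    Theorems.CircuitPumpNegative.Wrap Theorems.CircuitPumpNegative.IsPump := by
  obtain ⟨Λ, hΛ, q₀, hq₀, hq⟩ := hF hC hD
  refine circuitPump_of_coarseFamily Λ hΛ (q₀ + 1) ?_
  intro p hp hppos
  obtain ⟨q, rfl⟩ : ∃ q, p = q + 1 := ⟨p - 1, by omega⟩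
  obtain ⟨ε, K, G, hε, hK, hG, hcov⟩ := hq q (by omega)
  obtain ⟨C, A₁, A₂, g, h, hCc, hCconv, hCne, hA12, hg, hh, hmaps, hlo, hhi, hreal⟩ := hcov
  obtain ⟨A, hAI, y, hy, hgA, hhy⟩ :=
    clampFixedPoint_holds (StateSpace q) C A₁ A₂ g h hCc hCconv hCne hA12 hg hh hmaps hlo hhi
  have hW : OnePeriodWitness Λ q ε K G := hreal A (Ioo_subset_Icc_self hAI) y hy hgA hhy
  obtain ⟨Y, hsol, hdss, hTI, hnt⟩ := hB Λ hΛ q ε K G hW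
  exact hA Λ hΛ q (by omega) ε K G Y hsol hdss hTI hnt

/-- **The skeleton concludes the crux BY NAME** (the `#h21_check_skeleton` theorem): the five registered stubs,
fed to the sorry-free `circuitPump_of_parts`, give
`Summit.NavierStokesRegularity.NavierStokesRegularity.Theses.PerpetualPump.CircuitPump` through the landed
`circuitPump_iff` (`Iff.rfl`). Its axiom closure contains `sorryAx` exactly through the five `stub_*`. -/
theorem CircuitPump_of : Theses.PerpetualPump.CircuitPump :=
  Theorems.CircuitPumpNegative.circuitPump_iff.mpr
    (circuitPump_of_parts stub_gradedEmbedding stub_periodicExtension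
      stub_wireDelivery stub_coarseCollector stub_uniformClosing)

end Summit.NavierStokesRegularity.NavierStokesRegularity.Cruxes.CircuitPump.WireDecoupling

end
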